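import Literature.AlgebraicGeometry.Hu2025.Proofs.S03Pluecker.GammaQuadNotIntegral
import Literature.AlgebraicGeometry.Hu2025.Statements.S07GammaSchemes.R109aGamma
import HarnessLib

/-!
# Hu 2025 — bridge: the typed Γ-scheme carrier `Def7_1` (row 109, `S07GammaSchemes/R109aGamma.lean`) of the COMPLETE
# QUADRILATERAL at the row-101 platform `n = 9` is not a domain (joint J1 / GAP-LEDGER-HU row HU-R01 evidence, kernel)

**HONEST FRAMING (D-0012/D-0089).** [Hu2025] is an unrefereed preprint under adjudication; nothing of it is asserted. Row 109 types
Def 7.1's Γ-scheme by its coordinate ring `Def7_1 𝔉 Γ = 𝔽[x_u] ⧸ (I_Γ + (𝔉))` over a set `Γ` of chart-variable indices and a set `𝔉`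
of relations; at the platform of row 101 (`σ = plVar 9`, `𝔉 = 𝓕_m = primaryFamily 9 𝔽`) and `Γ =` the four lines
`{456, 478, 579, 689}` of the complete quadrilateral, this ideal is row 101's `gammaChartIdeal 𝔽 9 quadGamma`
(`gammaWpIdeal_quad_eq`), so `Proofs/S03Pluecker/GammaQuadNotIntegral.lean` gives: **`Def7_1 (𝓕_m) Γ_quad` is not a domain**
(every field `𝔽`; `not_isDomain_Def7_1_quad`). This is a statement about OUR typed objects; it bears on the J1 INFERENCE «X integral ⇒
Z_Γ integral» ([Hu22] p.131 l.40–41) as a kernel form of the tree certificate `Hu2025/GammaSchemeNotIntegral.lean`; it says nothing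
about [Hu2025] Thm 1.3 / 8.5 / 8.6, whose HYPOTHESIS «Z_Γ is integral» fails for this Γ. AI proof is weaker than expert review.
-/

noncomputable section

namespace Literature.AlgebraicGeometry.Hu2025.Statements.S07GammaSchemes

open MvPolynomial

/-- **`Γ` of the complete quadrilateral as a set of chart-variable INDICES** (row 109's `σ = plVar 9`): the variables `x_u`,
`u ∈ {456, 478, 579, 689}` (row 101's `S03Pluecker.quadGamma`). OURS.
[cite: Hu2025, Def. 7.1 (Γ-scheme Z_Γ), p.128; joint J1 = GAP-LEDGER-HU row HU-R01 (unrefereed preprint arXiv:2507.21400v1 under adjudication, D-0012/D-0089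
— kernel support on OUR typed carriers of row 101/109; nothing of the source asserted)] -/
def quadGammaVar : Set (S03Pluecker.plVar 9) := {x | x.1 ∈ S03Pluecker.quadGamma}

/-- At the platform, row 109's `I_{℘,Γ} = I_Γ + (𝓕_m)` for the quadrilateral is row 101's `gammaChartIdeal` (the two spans have
the same generators: `X ⟨u, _⟩ = x̄_u` for `u ∈ 𝕀_{3,9} ∖ m`).
[cite: Hu2025, Def. 7.1 (Γ-scheme Z_Γ), p.128; joint J1 = GAP-LEDGER-HU row HU-R01 (unrefereed preprint arXiv:2507.21400v1 under adjudication, D-0012/D-0089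
— kernel support on OUR typed carriers of row 101/109; nothing of the source asserted)] -/
theorem gammaWpIdeal_quad_eq (𝔽 : Type) [Field 𝔽] :
    gammaWpIdeal (S03Pluecker.primaryFamily 9 𝔽) quadGammaVar =
      S03Pluecker.gammaChartIdeal 𝔽 9 S03Pluecker.quadGamma := by
  unfold gammaWpIdeal gammaIdeal S03Pluecker.gammaChartIdeal
  rw [sup_comm]
  congr 1
  apply le_antisymm
  · rw [Ideal.span_le]
    rintro _ ⟨x, hx, rfl⟩
    dsimp only
    rw [show (X x : MvPolynomial (S03Pluecker.plVar 9) 𝔽) = S03Pluecker.xbar 𝔽 x.1 from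
      (S03Pluecker.xbar_of_mem 𝔽 x.2).symm]
    exact Ideal.subset_span ⟨x.1, hx, rfl⟩
  · rw [Ideal.span_le]
    rintro _ ⟨u, hu, rfl⟩
    have hu' : u ∈ S03Pluecker.plVarSet 9 := S03Pluecker.quadGamma_subset le_rfl hu
    dsimp only
    rw [S03Pluecker.xbar_of_mem 𝔽 hu']
    exact Ideal.subset_span ⟨⟨u, hu'⟩, hu, rfl⟩

/-- **The typed Γ-scheme carrier `Def7_1 (𝓕_m) Γ_quad` at `n = 9` is NOT A DOMAIN** (every field `𝔽`): «Z_Γ is not integral» for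
the complete quadrilateral, in row 109's own vocabulary.
[cite: Hu2025, Def. 7.1 (Γ-scheme Z_Γ), p.128; joint J1 = GAP-LEDGER-HU row HU-R01 (unrefereed preprint arXiv:2507.21400v1 under adjudication, D-0012/D-0089
— kernel support on OUR typed carriers of row 101/109; nothing of the source asserted)] -/
theorem not_isDomain_Def7_1_quad (𝔽 : Type) [Field 𝔽] :
    ¬ IsDomain (Def7_1 (S03Pluecker.primaryFamily 9 𝔽) quadGammaVar) := by
  unfold Def7_1 GammaSchemeRing
  rw [gammaWpIdeal_quad_eq]
  exact S03Pluecker.not_isDomain_gammaChart_quad_nine 𝔽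

/-- **The J1 standing hypothesis «Assume that Z_Γ is integral» ([Hu25] Thm 8.5 / 8.6 / 1.3; row 109's `ZGammaIntegral`) FAILS
for the complete quadrilateral at the platform `n = 9`, `𝔉 = 𝓕_m`** (every field `𝔽`): `¬ ZGammaIntegral (𝓕_m) Γ_quad` — the
same kernel fact as `not_isDomain_Def7_1_quad`, stated through row 109's OWN name for the hypothesis.
[cite: Hu2025, hypothesis «Assume that Z_Γ is integral» of Thm. 8.5 (C70L78; PDF p.156 l.6), Thm. 8.6 (C71L71; p.158 l.25), §1 p.16 l.12 / Thm. 1.3 p.17 l.11 (C08L106); Def. 7.1 p.128; joint J1 = GAP-LEDGER-HU row HU-R01 (unrefereed preprint arXiv:2507.21400v1 under adjudication, D-0012/D-0089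
— kernel support on OUR typed carriers of row 101/109; nothing of the source asserted)] -/
theorem not_ZGammaIntegral_quad (𝔽 : Type) [Field 𝔽] :
    ¬ ZGammaIntegral (S03Pluecker.primaryFamily 9 𝔽) quadGammaVar :=
  not_isDomain_Def7_1_quad 𝔽

/-! ## `0 ∈ Z_Γ` at the platform: row 109's `C57L24` with its hypothesis DISCHARGED for `𝔉 = 𝓕_m` -/

/-- Evaluation at the origin of the chart sends `x̄_t` to `0` for `t ≠ m` (and `x̄_m = 1` to `1`).
[cite: Hu2025, Def. 7.1 (Γ-scheme Z_Γ), p.128; joint J1 = GAP-LEDGER-HU row HU-R01 (unrefereed preprint arXiv:2507.21400v1 under adjudication, D-0012/D-0089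
— kernel support on OUR typed carriers of row 101/109; nothing of the source asserted)] -/
theorem eval_zero_xbar {n : ℕ} (𝔽 : Type) [Field 𝔽] {t : ℕ × ℕ × ℕ} (ht : t ≠ S03Pluecker.mTri) :
    MvPolynomial.eval (fun _ => (0 : 𝔽)) (S03Pluecker.xbar 𝔽 t : S03Pluecker.ChartRing n 𝔽) = 0 := by
  unfold S03Pluecker.xbar
  rw [if_neg ht]
  split_ifs with h
  · exact MvPolynomial.eval_X _
  · exact map_zero _

/-- **Every de-homogenised m-primary relation `F̄_{m,u}` vanishes at the origin of the chart** (each of its terms contains a chart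
variable `x̄_t`, `t ≠ m` — the four explicit forms (3.10)–(3.13), p.37): the hypothesis of row 109's `C57L24` holds for `𝔉 = 𝓕_m`.
[cite: Hu2025, Def. 7.1 «Note that Z_Γ ≠ ∅ since 0 ∈ Z_Γ» (C57L24), p.128; forms (3.10)–(3.13) p.37 (unrefereed preprint arXiv:2507.21400v1 under adjudication, D-0012/D-0089
— kernel support on OUR typed carriers of row 101/109; nothing of the source asserted)] -/
theorem eval_zero_primaryFamily {n : ℕ} (𝔽 : Type) [Field 𝔽] :
    ∀ F ∈ S03Pluecker.primaryFamily n 𝔽, MvPolynomial.eval (fun _ => (0 : 𝔽)) F = 0 := by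
  rintro _ ⟨u, hlt, rfl⟩
  have h2 : 3 < u.1.2.1 := S03Pluecker.three_lt_of_isLt u.2 hlt
  have h3 : 3 < u.1.2.2 := by
    have hidx := S03Pluecker.mem_plIndexSet_iff.mp u.2
    omega
  have hidx := S03Pluecker.mem_plIndexSet_iff.mp u.2
  have hne : ∀ a b c : ℕ, 3 < c → ((a, b, c) : ℕ × ℕ × ℕ) ≠ S03Pluecker.mTri := by
    intro a b c hc h
    unfold S03Pluecker.mTri at h
    simp only [Prod.mk.injEq] at h
    omega
  have hu : u.1 ≠ S03Pluecker.mTri := by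
    obtain ⟨⟨a, b, c⟩, hu'⟩ := u
    exact hne a b c h3
  have e0 := eval_zero_xbar (n := n) 𝔽 hu
  have e12b := eval_zero_xbar (n := n) 𝔽 (hne 1 2 _ h2)
  have e13b := eval_zero_xbar (n := n) 𝔽 (hne 1 3 _ h2)
  have e23b := eval_zero_xbar (n := n) 𝔽 (hne 2 3 _ h2)
  have e3bc := eval_zero_xbar (n := n) 𝔽 (hne 3 u.1.2.1 _ h3)
  have e2bc := eval_zero_xbar (n := n) 𝔽 (hne 2 u.1.2.1 _ h3)
  have e1bc := eval_zero_xbar (n := n) 𝔽 (hne 1 u.1.2.1 _ h3)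
  rw [S03Pluecker.primaryRelBar_eq 𝔽 u.1 hlt, S03Pluecker.xbar_mTri]
  split_ifs with c1 c2 c3
  · rw [map_add, map_sub, map_mul, map_mul, map_mul, e0, e12b, e13b]; ring
  · rw [map_add, map_sub, map_mul, map_mul, map_mul, e0, e12b, e23b]; ring
  · rw [map_add, map_sub, map_mul, map_mul, map_mul, e0, e13b, e23b]; ring
  · rw [map_sub, map_add, map_sub, map_mul, map_mul, map_mul, map_mul, e0, e3bc, e2bc, e1bc]; ring

/-- **`0 ∈ Z_Γ` AS TYPED, at the platform** (row 109's `C57L24` with `𝔉 = 𝓕_m`, its hypothesis discharged by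
`eval_zero_primaryFamily`): every element of `I_{℘,Γ}` vanishes at the origin, for every `n` and every `Γ`.
[cite: Hu2025, Def. 7.1 «Note that Z_Γ ≠ ∅ since 0 ∈ Z_Γ» (C57L24), p.128 (unrefereed preprint arXiv:2507.21400v1 under adjudication, D-0012/D-0089
— kernel support on OUR typed carriers of row 101/109; nothing of the source asserted)] -/
theorem C57L24_platform {n : ℕ} (𝔽 : Type) [Field 𝔽] (Γ : Set (S03Pluecker.plVar n)) :
    ∀ G ∈ gammaWpIdeal (S03Pluecker.primaryFamily n 𝔽) Γ, MvPolynomial.eval (fun _ => (0 : 𝔽)) G = 0 := by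
  intro G hG
  have hle : gammaWpIdeal (S03Pluecker.primaryFamily n 𝔽) Γ ≤ RingHom.ker (MvPolynomial.eval fun _ => (0 : 𝔽)) := by
    refine sup_le ?_ ?_
    · unfold gammaIdeal
      rw [Ideal.span_le]
      rintro _ ⟨u, -, rfl⟩
      rw [SetLike.mem_coe, RingHom.mem_ker]
      exact MvPolynomial.eval_X _
    · rw [Ideal.span_le]
      intro F hF
      rw [SetLike.mem_coe, RingHom.mem_ker]
      exact eval_zero_primaryFamily 𝔽 F hF
  exact RingHom.mem_ker.mp (hle hG)

end Literature.AlgebraicGeometry.Hu2025.Statements.S07GammaSchemes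

end
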